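import Mathlib
import Summits.Ventures.PercRepro.TriangleCapTopFourteen

/-!
# PercRepro — THE FIFTEENTH VALUE OF THE `K₄⁻`-FREE CHERRY TABLE: THE TOP OF THE FOURTH LAYER (p3, gen 50; part 223)

A `K₄⁻`-free graph at none of the fourteen values of the first three layers is at least `min (8 (r − 5)) (stabGapFull
k a r)` below the closed form (`bipSub_gap_three_layers` and the stability table), and the value is attained: the
`(r − 4)`-star at `0` minus four pairs from the vertex `1` to four leaves (`fourPairsAtVertex`, the `K_{2,4}` through
the star's centre; the four degree sums `2 (n − 1) + 2 (n − 2) + 2 (n − 3) + 2 (n − 4) = 8 n − 20`, the four-deletion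
arithmetic `four_deletions_arith_c`), or the non-bipartite witness — **`cherry_fifteenth_best`**.  Generator
`checks/mkwit.py` (four deletions).  Axioms: standard.
-/

namespace PercRepro

namespace TriangleCap

namespace C047

open Finset

/-- The arithmetic of four deletions from the `(r − 4)`-star with degree sums `D₁ + D₂ + D₃ + D₄ = 8 n − 20 + 2 c`:
`S₄ + r (n − 1 − r) + (8 (r − 5) + 2 c) = E₄ n`. -/
theorem four_deletions_arith_c (n r c E₀ E₄ S₀ S₁ S₂ S₃ S₄ D₁ D₂ D₃ D₄ : ℕ) (hr : 5 ≤ r) (hn : r + 1 ≤ n)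
    (hS0 : S₀ + (r - 4) * (n - 1 - (r - 4)) = E₀ * n) (hE : E₄ + 4 = E₀)
    (hS1 : S₁ + D₁ = S₀ + 2) (hS2 : S₂ + D₂ = S₁ + 2) (hS3 : S₃ + D₃ = S₂ + 2) (hS4 : S₄ + D₄ = S₃ + 2)
    (hD : D₁ + D₂ + D₃ + D₄ = 8 * n - 20 + 2 * c) :
    S₄ + r * (n - 1 - r) + (8 * (r - 5) + 2 * c) = E₄ * n := by
  obtain ⟨r', rfl⟩ : ∃ r', r = r' + 5 := ⟨r - 5, by omega⟩
  obtain ⟨t, rfl⟩ : ∃ t, n = r' + 6 + t := ⟨n - (r' + 6), by omega⟩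
  subst hE
  have e1 : r' + 5 - 4 = r' + 1 := by omega
  have e2 : r' + 6 + t - 1 - (r' + 1) = t + 4 := by omega
  have e3 : r' + 6 + t - 1 - (r' + 5) = t := by omega
  have e4 : r' + 5 - 5 = r' := by omega
  have e5 : 8 * (r' + 6 + t) - 20 = 8 * r' + 28 + 8 * t := by omega
  rw [e1, e2] at hS0
  rw [e5] at hD
  rw [e3, e4]
  zify at hS0 hS1 hS2 hS3 hS4 hD ⊢
  linear_combination hS0 + hS1 + hS2 + hS3 + hS4 - hD

/-- **FOUR PAIRS AT THE VERTEX 1 TO FOUR LEAVES** on `Fin n`: the `(r − 4)`-star at `0` minus the pairs `{1, a}`, `{1, a + 1}`, `{1, a + 2}`, `{1, a + 3}`. -/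
abbrev fourPairsAtVertex (n a r : ℕ) (h1 : 1 < n) (ha : a + 3 < n) : SimpleGraph (Fin n) :=
  delEdge (delEdge (delEdge (delEdge (bipMinusStar n a (r - 4)) ⟨1, h1⟩ ⟨a, by omega⟩) ⟨1, h1⟩ ⟨a + 1, by omega⟩) ⟨1, h1⟩ ⟨a + 2, by omega⟩) ⟨1, h1⟩ ⟨a + 3, by omega⟩

/-- **THE WITNESS FOR `8 (r − 5) + 0`** (FOUR PAIRS AT THE VERTEX 1 TO FOUR LEAVES): for `4 ≤ a`, `8 ≤ r`, `a + r ≤ n`, `r + 1 ≤ n`. -/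
theorem fourPairsAtVertex_value (n a r : ℕ) (ha4 : 4 ≤ a) (hr6 : 8 ≤ r) (han : a + r ≤ n) (hn : r + 1 ≤ n) :
    K4mFree (fourPairsAtVertex n a r (by omega) (by omega)) ∧
      (fourPairsAtVertex n a r (by omega) (by omega)).edgeFinset.card + r = a * (n - a) ∧
      ∑ v, deg (fourPairsAtVertex n a r (by omega) (by omega)) v * deg (fourPairsAtVertex n a r (by omega) (by omega)) v + r * (n - 1 - r) + (8 * (r - 5) + 2 * 0) =
        (fourPairsAtVertex n a r (by omega) (by omega)).edgeFinset.card * n := by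
  have hl1 : 1 < n := by omega
  have hf0 : a < n := by omega
  have hf1 : a + 1 < n := by omega
  have hf2 : a + 2 < n := by omega
  have hf3 : a + 3 < n := by omega
  have hadj0_1 := bipMinusStar_adj_cross n a (r - 4) (1) (a) (by omega) (by omega) (by omega) hl1 hf0
  have hadj0_2 := bipMinusStar_adj_cross n a (r - 4) (1) (a + 1) (by omega) (by omega) (by omega) hl1 hf1
  have hadj0_3 := bipMinusStar_adj_cross n a (r - 4) (1) (a + 2) (by omega) (by omega) (by omega) hl1 hf2
  have hadj0_4 := bipMinusStar_adj_cross n a (r - 4) (1) (a + 3) (by omega) (by omega) (by omega) hl1 hf3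
  have hd0_l1 : deg (bipMinusStar n a (r - 4)) ⟨1, hl1⟩ = n - a :=
    deg_bipMinusStar_small_left n a (r - 4) 1 (by omega) (by omega) (by omega) hl1
  have hd0_f0 : deg (bipMinusStar n a (r - 4)) ⟨a, hf0⟩ = a - 1 :=
    deg_bipMinusStar_leaf n a (r - 4) (a) (by omega) (by omega) (by omega) (by omega) hf0
  have hd0_f1 : deg (bipMinusStar n a (r - 4)) ⟨a + 1, hf1⟩ = a - 1 :=
    deg_bipMinusStar_leaf n a (r - 4) (a + 1) (by omega) (by omega) (by omega) (by omega) hf1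
  have hd0_f2 : deg (bipMinusStar n a (r - 4)) ⟨a + 2, hf2⟩ = a - 1 :=
    deg_bipMinusStar_leaf n a (r - 4) (a + 2) (by omega) (by omega) (by omega) (by omega) hf2
  have hd0_f3 : deg (bipMinusStar n a (r - 4)) ⟨a + 3, hf3⟩ = a - 1 :=
    deg_bipMinusStar_leaf n a (r - 4) (a + 3) (by omega) (by omega) (by omega) (by omega) hf3
  have hadj_1 := hadj0_1
  have hadj_2 : (delEdge (bipMinusStar n a (r - 4)) ⟨1, hl1⟩ ⟨a, hf0⟩).Adj ⟨1, hl1⟩ ⟨a + 1, hf1⟩ := by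
    rw [delEdge_adj]
    refine ⟨?_, by simp only [Fin.mk.injEq]; omega⟩
    exact hadj0_2
  have hd1_l1 : deg (delEdge (bipMinusStar n a (r - 4)) ⟨1, hl1⟩ ⟨a, hf0⟩) ⟨1, hl1⟩ = n - a - 1 := by
    have := deg_delEdge (bipMinusStar n a (r - 4)) hadj_1 ⟨1, hl1⟩
    rw [if_pos (Or.inl rfl)] at this
    omega
  have hd1_f0 : deg (delEdge (bipMinusStar n a (r - 4)) ⟨1, hl1⟩ ⟨a, hf0⟩) ⟨a, hf0⟩ = a - 1 - 1 := by
    have := deg_delEdge (bipMinusStar n a (r - 4)) hadj_1 ⟨a, hf0⟩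
    rw [if_pos (Or.inr rfl)] at this
    omega
  have hd1_f1 : deg (delEdge (bipMinusStar n a (r - 4)) ⟨1, hl1⟩ ⟨a, hf0⟩) ⟨a + 1, hf1⟩ = a - 1 := by
    have := deg_delEdge (bipMinusStar n a (r - 4)) hadj_1 ⟨a + 1, hf1⟩
    rw [if_neg (by simp only [Fin.mk.injEq]; omega)] at this
    omega
  have hd1_f2 : deg (delEdge (bipMinusStar n a (r - 4)) ⟨1, hl1⟩ ⟨a, hf0⟩) ⟨a + 2, hf2⟩ = a - 1 := by
    have := deg_delEdge (bipMinusStar n a (r - 4)) hadj_1 ⟨a + 2, hf2⟩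
    rw [if_neg (by simp only [Fin.mk.injEq]; omega)] at this
    omega
  have hd1_f3 : deg (delEdge (bipMinusStar n a (r - 4)) ⟨1, hl1⟩ ⟨a, hf0⟩) ⟨a + 3, hf3⟩ = a - 1 := by
    have := deg_delEdge (bipMinusStar n a (r - 4)) hadj_1 ⟨a + 3, hf3⟩
    rw [if_neg (by simp only [Fin.mk.injEq]; omega)] at this
    omega
  have hadj_3 : (delEdge (delEdge (bipMinusStar n a (r - 4)) ⟨1, hl1⟩ ⟨a, hf0⟩) ⟨1, hl1⟩ ⟨a + 1, hf1⟩).Adj ⟨1, hl1⟩ ⟨a + 2, hf2⟩ := by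
    rw [delEdge_adj]
    refine ⟨?_, by simp only [Fin.mk.injEq]; omega⟩
    rw [delEdge_adj]
    refine ⟨?_, by simp only [Fin.mk.injEq]; omega⟩
    exact hadj0_3
  have hd2_l1 : deg (delEdge (delEdge (bipMinusStar n a (r - 4)) ⟨1, hl1⟩ ⟨a, hf0⟩) ⟨1, hl1⟩ ⟨a + 1, hf1⟩) ⟨1, hl1⟩ = n - a - 2 := by
    have := deg_delEdge (delEdge (bipMinusStar n a (r - 4)) ⟨1, hl1⟩ ⟨a, hf0⟩) hadj_2 ⟨1, hl1⟩
    rw [if_pos (Or.inl rfl)] at this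
    omega
  have hd2_f0 : deg (delEdge (delEdge (bipMinusStar n a (r - 4)) ⟨1, hl1⟩ ⟨a, hf0⟩) ⟨1, hl1⟩ ⟨a + 1, hf1⟩) ⟨a, hf0⟩ = a - 1 - 1 := by
    have := deg_delEdge (delEdge (bipMinusStar n a (r - 4)) ⟨1, hl1⟩ ⟨a, hf0⟩) hadj_2 ⟨a, hf0⟩
    rw [if_neg (by simp only [Fin.mk.injEq]; omega)] at this
    omega
  have hd2_f1 : deg (delEdge (delEdge (bipMinusStar n a (r - 4)) ⟨1, hl1⟩ ⟨a, hf0⟩) ⟨1, hl1⟩ ⟨a + 1, hf1⟩) ⟨a + 1, hf1⟩ = a - 1 - 1 := by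
    have := deg_delEdge (delEdge (bipMinusStar n a (r - 4)) ⟨1, hl1⟩ ⟨a, hf0⟩) hadj_2 ⟨a + 1, hf1⟩
    rw [if_pos (Or.inr rfl)] at this
    omega
  have hd2_f2 : deg (delEdge (delEdge (bipMinusStar n a (r - 4)) ⟨1, hl1⟩ ⟨a, hf0⟩) ⟨1, hl1⟩ ⟨a + 1, hf1⟩) ⟨a + 2, hf2⟩ = a - 1 := by
    have := deg_delEdge (delEdge (bipMinusStar n a (r - 4)) ⟨1, hl1⟩ ⟨a, hf0⟩) hadj_2 ⟨a + 2, hf2⟩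
    rw [if_neg (by simp only [Fin.mk.injEq]; omega)] at this
    omega
  have hd2_f3 : deg (delEdge (delEdge (bipMinusStar n a (r - 4)) ⟨1, hl1⟩ ⟨a, hf0⟩) ⟨1, hl1⟩ ⟨a + 1, hf1⟩) ⟨a + 3, hf3⟩ = a - 1 := by
    have := deg_delEdge (delEdge (bipMinusStar n a (r - 4)) ⟨1, hl1⟩ ⟨a, hf0⟩) hadj_2 ⟨a + 3, hf3⟩
    rw [if_neg (by simp only [Fin.mk.injEq]; omega)] at this
    omega
  have hadj_4 : (delEdge (delEdge (delEdge (bipMinusStar n a (r - 4)) ⟨1, hl1⟩ ⟨a, hf0⟩) ⟨1, hl1⟩ ⟨a + 1, hf1⟩) ⟨1, hl1⟩ ⟨a + 2, hf2⟩).Adj ⟨1, hl1⟩ ⟨a + 3, hf3⟩ := by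
    rw [delEdge_adj]
    refine ⟨?_, by simp only [Fin.mk.injEq]; omega⟩
    rw [delEdge_adj]
    refine ⟨?_, by simp only [Fin.mk.injEq]; omega⟩
    rw [delEdge_adj]
    refine ⟨?_, by simp only [Fin.mk.injEq]; omega⟩
    exact hadj0_4
  have hd3_l1 : deg (delEdge (delEdge (delEdge (bipMinusStar n a (r - 4)) ⟨1, hl1⟩ ⟨a, hf0⟩) ⟨1, hl1⟩ ⟨a + 1, hf1⟩) ⟨1, hl1⟩ ⟨a + 2, hf2⟩) ⟨1, hl1⟩ = n - a - 3 := by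
    have := deg_delEdge (delEdge (delEdge (bipMinusStar n a (r - 4)) ⟨1, hl1⟩ ⟨a, hf0⟩) ⟨1, hl1⟩ ⟨a + 1, hf1⟩) hadj_3 ⟨1, hl1⟩
    rw [if_pos (Or.inl rfl)] at this
    omega
  have hd3_f0 : deg (delEdge (delEdge (delEdge (bipMinusStar n a (r - 4)) ⟨1, hl1⟩ ⟨a, hf0⟩) ⟨1, hl1⟩ ⟨a + 1, hf1⟩) ⟨1, hl1⟩ ⟨a + 2, hf2⟩) ⟨a, hf0⟩ = a - 1 - 1 := by
    have := deg_delEdge (delEdge (delEdge (bipMinusStar n a (r - 4)) ⟨1, hl1⟩ ⟨a, hf0⟩) ⟨1, hl1⟩ ⟨a + 1, hf1⟩) hadj_3 ⟨a, hf0⟩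
    rw [if_neg (by simp only [Fin.mk.injEq]; omega)] at this
    omega
  have hd3_f1 : deg (delEdge (delEdge (delEdge (bipMinusStar n a (r - 4)) ⟨1, hl1⟩ ⟨a, hf0⟩) ⟨1, hl1⟩ ⟨a + 1, hf1⟩) ⟨1, hl1⟩ ⟨a + 2, hf2⟩) ⟨a + 1, hf1⟩ = a - 1 - 1 := by
    have := deg_delEdge (delEdge (delEdge (bipMinusStar n a (r - 4)) ⟨1, hl1⟩ ⟨a, hf0⟩) ⟨1, hl1⟩ ⟨a + 1, hf1⟩) hadj_3 ⟨a + 1, hf1⟩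
    rw [if_neg (by simp only [Fin.mk.injEq]; omega)] at this
    omega
  have hd3_f2 : deg (delEdge (delEdge (delEdge (bipMinusStar n a (r - 4)) ⟨1, hl1⟩ ⟨a, hf0⟩) ⟨1, hl1⟩ ⟨a + 1, hf1⟩) ⟨1, hl1⟩ ⟨a + 2, hf2⟩) ⟨a + 2, hf2⟩ = a - 1 - 1 := by
    have := deg_delEdge (delEdge (delEdge (bipMinusStar n a (r - 4)) ⟨1, hl1⟩ ⟨a, hf0⟩) ⟨1, hl1⟩ ⟨a + 1, hf1⟩) hadj_3 ⟨a + 2, hf2⟩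
    rw [if_pos (Or.inr rfl)] at this
    omega
  have hd3_f3 : deg (delEdge (delEdge (delEdge (bipMinusStar n a (r - 4)) ⟨1, hl1⟩ ⟨a, hf0⟩) ⟨1, hl1⟩ ⟨a + 1, hf1⟩) ⟨1, hl1⟩ ⟨a + 2, hf2⟩) ⟨a + 3, hf3⟩ = a - 1 := by
    have := deg_delEdge (delEdge (delEdge (bipMinusStar n a (r - 4)) ⟨1, hl1⟩ ⟨a, hf0⟩) ⟨1, hl1⟩ ⟨a + 1, hf1⟩) hadj_3 ⟨a + 3, hf3⟩
    rw [if_neg (by simp only [Fin.mk.injEq]; omega)] at this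
    omega
  have hS0 := sum_deg_sq_bipMinusStar n a (r - 4) (by omega) (by omega) (by omega)
  rw [Fintype.card_fin] at hS0
  have hE0 := card_edges_bipMinusStar n a (r - 4) (by omega) (by omega)
  have hE1 := card_edges_delEdge (bipMinusStar n a (r - 4)) hadj_1
  have hS1 := sum_deg_sq_delEdge (bipMinusStar n a (r - 4)) hadj_1
  rw [hd0_l1, hd0_f0] at hS1
  have hE2 := card_edges_delEdge (delEdge (bipMinusStar n a (r - 4)) ⟨1, hl1⟩ ⟨a, hf0⟩) hadj_2
  have hS2 := sum_deg_sq_delEdge (delEdge (bipMinusStar n a (r - 4)) ⟨1, hl1⟩ ⟨a, hf0⟩) hadj_2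
  rw [hd1_l1, hd1_f1] at hS2
  have hE3 := card_edges_delEdge (delEdge (delEdge (bipMinusStar n a (r - 4)) ⟨1, hl1⟩ ⟨a, hf0⟩) ⟨1, hl1⟩ ⟨a + 1, hf1⟩) hadj_3
  have hS3 := sum_deg_sq_delEdge (delEdge (delEdge (bipMinusStar n a (r - 4)) ⟨1, hl1⟩ ⟨a, hf0⟩) ⟨1, hl1⟩ ⟨a + 1, hf1⟩) hadj_3
  rw [hd2_l1, hd2_f2] at hS3
  have hE4 := card_edges_delEdge (delEdge (delEdge (delEdge (bipMinusStar n a (r - 4)) ⟨1, hl1⟩ ⟨a, hf0⟩) ⟨1, hl1⟩ ⟨a + 1, hf1⟩) ⟨1, hl1⟩ ⟨a + 2, hf2⟩) hadj_4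
  have hS4 := sum_deg_sq_delEdge (delEdge (delEdge (delEdge (bipMinusStar n a (r - 4)) ⟨1, hl1⟩ ⟨a, hf0⟩) ⟨1, hl1⟩ ⟨a + 1, hf1⟩) ⟨1, hl1⟩ ⟨a + 2, hf2⟩) hadj_4
  rw [hd3_l1, hd3_f3] at hS4
  refine ⟨?_, ?_, ?_⟩
  · exact (k4mFree_of_le _ _ (delEdge_le _ _ _) (k4mFree_of_le _ _ (delEdge_le _ _ _) (k4mFree_of_le _ _ (delEdge_le _ _ _) (k4mFree_of_le _ _ (delEdge_le _ _ _) (k4mFree_bipMinusStar n a (r - 4))))))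
  · show (delEdge (delEdge (delEdge (delEdge (bipMinusStar n a (r - 4)) ⟨1, hl1⟩ ⟨a, hf0⟩) ⟨1, hl1⟩ ⟨a + 1, hf1⟩) ⟨1, hl1⟩ ⟨a + 2, hf2⟩) ⟨1, hl1⟩ ⟨a + 3, hf3⟩).edgeFinset.card + r = a * (n - a)
    omega
  · show ∑ v, deg (delEdge (delEdge (delEdge (delEdge (bipMinusStar n a (r - 4)) ⟨1, hl1⟩ ⟨a, hf0⟩) ⟨1, hl1⟩ ⟨a + 1, hf1⟩) ⟨1, hl1⟩ ⟨a + 2, hf2⟩) ⟨1, hl1⟩ ⟨a + 3, hf3⟩) v * deg (delEdge (delEdge (delEdge (delEdge (bipMinusStar n a (r - 4)) ⟨1, hl1⟩ ⟨a, hf0⟩) ⟨1, hl1⟩ ⟨a + 1, hf1⟩) ⟨1, hl1⟩ ⟨a + 2, hf2⟩) ⟨1, hl1⟩ ⟨a + 3, hf3⟩) v + r * (n - 1 - r) + (8 * (r - 5) + 2 * 0) =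
      (delEdge (delEdge (delEdge (delEdge (bipMinusStar n a (r - 4)) ⟨1, hl1⟩ ⟨a, hf0⟩) ⟨1, hl1⟩ ⟨a + 1, hf1⟩) ⟨1, hl1⟩ ⟨a + 2, hf2⟩) ⟨1, hl1⟩ ⟨a + 3, hf3⟩).edgeFinset.card * n
    exact four_deletions_arith_c n r 0 _ _ _ _ _ _ _ _ _ _ _ (by omega) hn hS0 (by omega) hS1 hS2 hS3 hS4 (by omega)

/-- **THE FIFTEENTH-BEST VALUE OF THE CHERRY TABLE:** on every cell with `4 ≤ a`, `15 ≤ r`, `2 a + r ≤ k`, a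
`K₄⁻`-free graph at none of the fourteen gaps of the first three layers is at least `min (8 (r − 5)) (stabGapFull k a r)`
below the closed form, and the value is attained (`fourPairsAtVertex` when `8 (r − 5) ≤ stabGapFull`, the
non-bipartite witness otherwise). -/
theorem cherry_fifteenth_best (k a r : ℕ) (ha4 : 4 ≤ a) (hr15 : 15 ≤ r) (hk : 2 * a + r ≤ k) :
    (∀ (D : SimpleGraph (Fin k)) [DecidableRel D.Adj], K4mFree D → D.edgeFinset.card + r = a * (k - a) →
        (∀ g ∈ ({0, 2 * (r - 2), 2 * (r - 1), 4 * (r - 3), 4 * (r - 3) + 2, 4 * (r - 3) + 4, 4 * (r - 3) + 6,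
          6 * (r - 4), 6 * (r - 4) + 2, 6 * (r - 4) + 4, 6 * (r - 4) + 6, 6 * (r - 4) + 8, 6 * (r - 4) + 10,
          6 * (r - 4) + 12} : Finset ℕ), ∑ v, deg D v * deg D v + r * (k - 1 - r) + g ≠ D.edgeFinset.card * k) →
        ∑ v, deg D v * deg D v + r * (k - 1 - r) + min (8 * (r - 5)) (stabGapFull k a r) ≤
          D.edgeFinset.card * k) ∧
      ∃ (D : SimpleGraph (Fin k)) (_ : DecidableRel D.Adj), K4mFree D ∧ D.edgeFinset.card + r = a * (k - a) ∧
        ∑ v, deg D v * deg D v + r * (k - 1 - r) + min (8 * (r - 5)) (stabGapFull k a r) =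
          D.edgeFinset.card * k := by
  have hcard : Fintype.card (Fin k) = k := Fintype.card_fin k
  have hk3 : a = 3 → r + 7 ≤ k := fun h => by omega
  refine ⟨?_, ?_⟩
  · intro D _ hK hm hne
    by_cases hbip : ∃ A : Finset (Fin k), A.card = a ∧ BipSub D A
    · obtain ⟨A, hA, hB⟩ := hbip
      have hl := bipSub_gap_three_layers D A hB a r hA (by rw [hcard]; exact hm) hr15 (by rw [hcard]; omega)
      rw [hcard] at hl
      have hmin := min_le_left (8 * (r - 5)) (stabGapFull k a r)
      simp only [mem_insert, mem_singleton, forall_eq_or_imp, forall_eq] at hne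
      obtain ⟨h0, h1, h2, h3, h4, h5, h6, h7, h8, h9, h10, h11, h12, h13⟩ := hne
      rcases hl with h | ⟨j, hj, h⟩ | ⟨j, hj, h⟩ | ⟨j, hj, h⟩ | h
      · omega
      · interval_cases j <;> omega
      · interval_cases j <;> omega
      · interval_cases j <;> omega
      · omega
    · have h := (stab_table_rows_ge_three k a r (by omega) hk (by omega) hk3).1 D hK hm hbip
      have hmin := min_le_right (8 * (r - 5)) (stabGapFull k a r)
      omega
  · by_cases hle : 8 * (r - 5) ≤ stabGapFull k a r
    · rw [min_eq_left hle]
      obtain ⟨hK, hE, hS⟩ := fourPairsAtVertex_value k a r ha4 (by omega) (by omega) (by omega)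
      exact ⟨fourPairsAtVertex k a r (by omega) (by omega), inferInstance, hK, hE, by rw [mul_zero, add_zero] at hS; exact hS⟩
    · rw [min_eq_right (le_of_lt (not_le.mp hle))]
      obtain ⟨D, inst, hK, hE, -, hS⟩ := (stab_table_rows_ge_three k a r (by omega) hk (by omega) hk3).2
      exact ⟨D, inst, hK, hE, hS⟩

end C047

end TriangleCap

end PercRepro
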